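import Summits.Ventures.PercRepro.ThetaMultiProjStep

/-!
# (Θ_∞): the weak split step — any labelling of the projection, the credit

Dossier proofs/MINE1-theoremS.md, Addendum 76 (mine-1, gen 39). The projection step of
ThetaMultiProjStep.lean gives the partner family `partE e A` to the induction hypothesis. It need
not: the bookkeeping `|multiDRel U A| = |D_e'| + |D_{¬e}| = |D_e' ∪ D_{¬e}| + |D_e' ∩ D_{¬e}|`
holds with the **credit** `creditE U e A = D_e' ∩ D_{¬e}` (the `e`-free members of the family
whose `e`-extension is a member: the `e`-edges of the family) in place of the partner family, and
the union part covers the family of **any** sub-labelling `T` of the projection (`T i ⊆ projE e A i`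
for every class `i`) — at an inconsistent point one keeps one label per projected set and the
projected instance is valid again, at the price of the count `∑ᵢ |projE e A i| − ∑ᵢ |T i|`.

* `card_multiDRel_add_card_creditE_le_of_subset_projE` — **the exact step for a sub-labelling**:
  `|multiDRel (U ∖ e) T| + |creditE U e A| ≤ |multiDRel U A|` for every `e` and every `T` below
  the projection (no validity, no consistency);
* `sum_card_le_card_multiDRel_of_subset_projE` — **the weak split step**: if (Θ_∞) holds on
  `U ∖ e` for `T` and the partner pairs at `e` are paid by the credit,
  `∑ᵢ |projE e A i| + ∑ᵢ |partE e A i| ≤ ∑ᵢ |T i| + |creditE U e A|`, then (Θ_∞) holds on `U` for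
  `A`;
* `multiDRel_partE_subset_creditE` — the partner family's family lies in the credit (so the step
  of ThetaMultiProjStep.lean is the case `T = projE e A`, partners paid by their own family).

The Split Lemma of Addenda 73–75 is therefore the statement «some point `e` and some labelling
`T` of its projection have `∑ᵢ |projE e A i| + ∑ᵢ |partE e A i| ≤ ∑ᵢ |T i| + |creditE U e A|»:
the partner family's own inequality is never needed, and the credit is a choice-free count.
-/

namespace PercRepro.MSTight

open Finset
open scoped FinsetFamily

variable {α : Type*} [DecidableEq α] [Fintype α]
variable {ι : Type*} [DecidableEq ι] [Fintype ι]

section WeakStep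

/-- The **credit** of the multi-class family at `e`: the `e`-free members whose `e`-extension is
a member too (the `e`-edges of `multiDRel U A`). -/
def creditE (U : Finset α) (e : α) (A : ι → Finset (Finset α)) : Finset (Finset α) :=
  (multiDRel U A).filter fun d => e ∉ d ∧ insert e d ∈ multiDRel U A

variable {U : Finset α} {e : α} {A T : ι → Finset (Finset α)}

omit [Fintype α] in
/-- Membership in the credit. -/
theorem mem_creditE {d : Finset α} :
    d ∈ creditE U e A ↔ d ∈ multiDRel U A ∧ e ∉ d ∧ insert e d ∈ multiDRel U A := by
  unfold creditE
  simp only [mem_filter]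

omit [Fintype α] in
/-- The family of a sub-labelling of the projection lies in the projection of `multiDRel U A`. -/
theorem exists_erase_eq_of_mem_multiDRel_of_subset_projE (hT : ∀ i, T i ⊆ projE e A i)
    {E' : Finset α} (h : E' ∈ multiDRel (U.erase e) T) : ∃ E ∈ multiDRel U A, E.erase e = E' := by
  rw [mem_multiDRel] at h
  rcases h with rfl | ⟨i, h⟩ | ⟨i, j, hij, h⟩
  · exact ⟨∅, empty_mem_multiDRel U A, erase_empty e⟩
  · rw [mem_diffs] at h
    obtain ⟨x', hx', y', hy', rfl⟩ := h
    obtain ⟨x, hx, rfl⟩ := mem_projE.1 (hT i hx')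
    obtain ⟨y, hy, rfl⟩ := mem_projE.1 (hT i hy')
    exact ⟨x \ y, mem_multiDRel_of_mem_diffs i (sdiff_mem_diffs hx hy), (erase_sdiff_erase' x y).symm⟩
  · rw [mem_crossDRel] at h
    rcases h with ⟨x', hx', y', hy', rfl⟩ | ⟨x', hx', y', hy', rfl⟩
    · obtain ⟨x, hx, rfl⟩ := mem_projE.1 (hT i hx')
      obtain ⟨y, hy, rfl⟩ := mem_projE.1 (hT j hy')
      exact ⟨x ⊓ y, inf_mem_multiDRel hij hx hy, (erase_inf_erase' x y).symm⟩
    · obtain ⟨x, hx, rfl⟩ := mem_projE.1 (hT i hx')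
      obtain ⟨y, hy, rfl⟩ := mem_projE.1 (hT j hy')
      exact ⟨U \ (x ⊔ y), sdiff_sup_mem_multiDRel hij hx hy, (erase_sdiff_sup_erase' U x y).symm⟩

omit [Fintype α] in
/-- **The exact step for a sub-labelling of the projection**: for every `e` and every `T` with
`T i ⊆ projE e A i`, `|multiDRel (U ∖ e) T| + |creditE U e A| ≤ |multiDRel U A|`. -/
theorem card_multiDRel_add_card_creditE_le_of_subset_projE (hT : ∀ i, T i ⊆ projE e A i) :
    (multiDRel (U.erase e) T).card + (creditE U e A).card ≤ (multiDRel U A).card := by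
  set D := multiDRel U A with hD
  set De' := (D.filter fun E => e ∈ E).image fun E => E.erase e with hDe'
  set Dn := D.filter fun E => e ∉ E with hDn
  have hsplit : D.card = (D.filter fun E => e ∈ E).card + Dn.card :=
    (card_filter_add_card_filter_not (s := D) fun E => e ∈ E).symm
  have hP : multiDRel (U.erase e) T ⊆ De' ∪ Dn := by
    intro E' hE'
    obtain ⟨E, hE, rfl⟩ := exists_erase_eq_of_mem_multiDRel_of_subset_projE hT hE'
    rw [mem_union]
    by_cases he : e ∈ E
    · exact Or.inl (mem_image.2 ⟨E, mem_filter.2 ⟨hE, he⟩, rfl⟩)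
    · rw [erase_eq_of_notMem he]
      exact Or.inr (mem_filter.2 ⟨hE, he⟩)
  have hC : creditE U e A ⊆ De' ∩ Dn := by
    intro d hd
    obtain ⟨h1, h2, h3⟩ := mem_creditE.1 hd
    rw [mem_inter]
    exact ⟨mem_image.2 ⟨insert e d, mem_filter.2 ⟨h3, mem_insert_self e d⟩, erase_insert h2⟩,
      mem_filter.2 ⟨h1, h2⟩⟩
  calc (multiDRel (U.erase e) T).card + (creditE U e A).card
      ≤ (De' ∪ Dn).card + (De' ∩ Dn).card := Nat.add_le_add (card_le_card hP) (card_le_card hC)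
    _ = De'.card + Dn.card := card_union_add_card_inter _ _
    _ = D.card := by rw [hDe', card_filter_mem_image_erase, hsplit]

omit [Fintype α] in
/-- **The weak split step of (Θ_∞)**: (Θ_∞) on `U ∖ e` for a sub-labelling `T` of the projection,
and the partner pairs at `e` paid by the credit, give (Θ_∞) on `U` for `A`. -/
theorem sum_card_le_card_multiDRel_of_subset_projE (hT : ∀ i, T i ⊆ projE e A i)
    (hP : ∑ i, (T i).card ≤ (multiDRel (U.erase e) T).card)
    (hK : ∑ i, (projE e A i).card + ∑ i, (partE e A i).card ≤
      ∑ i, (T i).card + (creditE U e A).card) :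
    ∑ i, (A i).card ≤ (multiDRel U A).card := by
  have hsum : ∑ i, (A i).card = ∑ i, (projE e A i).card + ∑ i, (partE e A i).card := by
    rw [← sum_add_distrib]
    exact Finset.sum_congr rfl fun i _ => (card_projE_add_card_partE i).symm
  calc ∑ i, (A i).card = ∑ i, (projE e A i).card + ∑ i, (partE e A i).card := hsum
    _ ≤ ∑ i, (T i).card + (creditE U e A).card := hK
    _ ≤ (multiDRel (U.erase e) T).card + (creditE U e A).card := Nat.add_le_add_right hP _
    _ ≤ (multiDRel U A).card := card_multiDRel_add_card_creditE_le_of_subset_projE hT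

omit [Fintype α] in
/-- **The partner family's family lies in the credit** (given `e ∈ U` and a partner pair): the
step of ThetaMultiProjStep.lean is the weak step with `T = projE e A` and the partners paid by
their own family. -/
theorem multiDRel_partE_subset_creditE (hU : e ∈ U) (hK : ∃ i, (partE e A i).Nonempty) :
    multiDRel (U.erase e) (partE e A) ⊆ creditE U e A := fun _ hE' =>
  mem_creditE.2 (mem_and_insert_mem_of_mem_multiDRel_partE hU hK hE')

omit [Fintype α] in
/-- The credit pays the partners as soon as (Θ_∞) holds for the partner family. -/
theorem sum_card_partE_le_card_creditE (hU : e ∈ U)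
    (hK : ∑ i, (partE e A i).card ≤ (multiDRel (U.erase e) (partE e A)).card) :
    ∑ i, (partE e A i).card ≤ (creditE U e A).card := by
  by_cases hpart : ∃ i, (partE e A i).Nonempty
  · exact hK.trans (card_le_card (multiDRel_partE_subset_creditE hU hpart))
  · simp only [not_exists, not_nonempty_iff_eq_empty] at hpart
    have hzero : ∑ i, (partE e A i).card = 0 :=
      Finset.sum_eq_zero fun i _ => by rw [card_eq_zero]; exact hpart i
    rw [hzero]
    exact Nat.zero_le _

end WeakStep

end PercRepro.MSTight
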